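import Literature.Probability.LatticeModels.GridDomainHittingProbability
import Literature.Probability.LatticeModels.KilledWalkLaplacian
import HarnessLib

/-!
# Boundary hitting in grid domains (LSW 2004, Lemma 5.3) — proved steps, I:
# the hitting probability as a killed-harmonic function

Topic `Literature/Probability/LatticeModels`; sibling of `GridDomainHittingProbability.lean`, which
STATES G. F. Lawler, O. Schramm, W. Werner, *Conformal invariance of planar loop-erased random walks
and uniform spanning trees*, Ann. Probab. 32 (2004), Lemma 5.3 (arXiv math/0112234, Lemma 33)
as the named fact `boundaryHitting`: for `D ∈ 𝔇`, `w ∈ V(D)` with `|ψ_D(w)| ≥ 1 - δ`, the simple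
random walk from `w` hits `{v ∈ V(D) : |ψ_D(v) - ψ_D(w)| > ε₁}` before `∂D` with probability
`≤ ε₂`. The probability in question is the tree's
`LSWGrid.hitBeforeExitProb D w B = 1 - Σ'_q SRW.exitAfterAvoiding (siteGraph V(D)) w q B`
(one minus the mass of the excursions from `w` killed — first step out of `V(D)` — before any
visit to `B`, summed over the last vertex `q` before the killing).

This file proves the bookkeeping half of any proof of the lemma (the printed proof, §5.1 of the
paper, argues with "the probability that simple random walk started at `w` will hit … before
hitting `∂D`" as a discrete-harmonic function of `w` and with the Markov property): everything
below is [folklore], fully proved, and introduces no definition and no named fact.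

* `SRW.disjoint_iUnion_exitEvent` — distinct last vertices `q ≠ q'` give disjoint events;
  `SRW.tsum_exitAfterAvoiding_eq_measureReal` — `Σ'_q E(p,q,A)` is the probability of ONE event
  (the walk is killed at a finite time and avoids `A` up to then); hence
  `SRW.summable_exitAfterAvoiding`, `SRW.tsum_exitAfterAvoiding_le_one`, `_nonneg`, and
  monotonicity in the avoided set `SRW.tsum_exitAfterAvoiding_mono`.
* `SRW.tsum_exitAfterAvoiding_first_step` — the first-step equation summed over the last vertex:
  for `p ∉ A`, `Σ'_q E(p,q,A) = #killingDirs(p)/(2d) + (2d)⁻¹ Σ_{e : p ∼ p+e} Σ'_q E(p+e,q,A)`.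
* On `ℤ²`: the function `v ↦ 1 - Σ'_q E(v,q,A)` — the probability of visiting `A` before the
  killing, or of never being killed — is **harmonic for the killed walk** on `Aᶜ` in the sense of
  `KilledWalkLaplacian.lean` (`isKilledHarmonicOn_one_sub_tsum_exitAfterAvoiding`), equals `1` on
  `A`, vanishes at the sites with no `Gr`-edge, and takes values in `[0,1]`; so on every finite
  `S ⊆ Aᶜ` it is the solution `killedHarmExt` of its own Dirichlet problem and the maximum /
  comparison principles of that file apply to it.
* For the walk of the lemma (`Gr = siteGraph V`, `A ⊆ V`): the same function vanishes off `V` and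
  is **lattice harmonic** on `V ∖ A` (`isLatticeHarmonicOn_one_sub_tsum_exitAfterAvoiding`), the
  form consumed by the weak Beurling estimate (`WeakBeurlingEstimate.lean`) and the lattice maximum
  principle (`LatticeLaplacian.lean`); and `LSWGrid.hitBeforeExitProb` inherits all of it
  (`LSWGrid.hitBeforeExitProb_mem_Icc`, `_mono`, `_eq_one_of_mem`, `_isLatticeHarmonicOn`,
  `_le_of_subset_union`: enlarging the avoided set by the sites outside a finite window gives an
  upper bound by a finite Dirichlet problem).

## References

* G. F. Lawler, O. Schramm, W. Werner, Ann. Probab. 32 (2004) 939–995, §5.1, Lemma 5.3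
  [LawlerSchrammWerner2004].
* G. F. Lawler, V. Limic, *Random Walk: A Modern Introduction*, CUP (2010), §6.1–6.2 (Dirichlet
  problem and hitting probabilities of the killed walk) [LawlerLimic2010].
-/

noncomputable section

open MeasureTheory Set
open scoped Classical
open Literature.Probability.RandomPlanarGeometry (ChordalLERW.siteGraph ChordalLERW.siteGraph_adj_iff)

namespace Literature.Probability.LatticeModels

namespace SRW

variable {d : ℕ}

/-! ### The excursion mass summed over the last vertex is the probability of one event -/

/-- Distinct last vertices before the killing give disjoint events: the killing time of a path is
unique, and so is the position at that time. [folklore] -/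
theorem disjoint_iUnion_exitEvent (Gr : SimpleGraph (Site d)) (p : Site d) (A : Set (Site d)) :
    Pairwise (Function.onFun Disjoint fun q => ⋃ n, exitEvent Gr n p q A) := by
  intro q q' hqq'
  refine Set.disjoint_left.2 fun ω hq hq' => hqq' ?_
  simp only [Set.mem_iUnion, exitEvent, Set.mem_setOf_eq] at hq hq'
  obtain ⟨n, hn1, hn2, hn3, -⟩ := hq
  obtain ⟨m, hm1, hm2, hm3, -⟩ := hq'
  rcases lt_trichotomy n m with h | rfl | h
  · exact absurd (hm1 n h) hn2
  · exact hn3.symm.trans hm3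
  · exact absurd (hn1 m h) hm2

/-- The union over the last vertex of the exit events is measurable. [folklore] -/
theorem measurableSet_iUnion_exitEvent (Gr : SimpleGraph (Site d)) (p q : Site d) (A : Set (Site d)) :
    MeasurableSet (⋃ n, exitEvent Gr n p q A) :=
  MeasurableSet.iUnion fun n => measurableSet_exitEvent Gr n p q A

/-- `E(p,q,A)` is the probability of `⋃ₙ exitEvent n`. [folklore] -/
theorem exitAfterAvoiding_eq_measureReal_iUnion [NeZero d] (Gr : SimpleGraph (Site d)) (p q : Site d)
    (A : Set (Site d)) :
    exitAfterAvoiding Gr p q A = (pathLaw d).real (⋃ n, exitEvent Gr n p q A) := by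
  rw [exitAfterAvoiding, setOf_exists_eq_iUnion_exitEvent]

/-- **`Σ'_q E(p,q,A)` is the probability that the killed walk from `p` is killed at a finite time
having avoided `A` up to then** (countable additivity over the last vertex). [folklore] -/
theorem tsum_exitAfterAvoiding_eq_measureReal [NeZero d] (Gr : SimpleGraph (Site d)) (p : Site d)
    (A : Set (Site d)) :
    ∑' q, exitAfterAvoiding Gr p q A = (pathLaw d).real (⋃ q, ⋃ n, exitEvent Gr n p q A) := by
  simp_rw [exitAfterAvoiding_eq_measureReal_iUnion, measureReal_def]
  rw [measure_iUnion (disjoint_iUnion_exitEvent Gr p A) (fun q => measurableSet_iUnion_exitEvent Gr p q A),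
    ENNReal.tsum_toReal_eq fun q => measure_ne_top _ _]

/-- The series `Σ_q E(p,q,A)` converges. [folklore] -/
theorem summable_exitAfterAvoiding [NeZero d] (Gr : SimpleGraph (Site d)) (p : Site d) (A : Set (Site d)) :
    Summable fun q => exitAfterAvoiding Gr p q A := by
  simp_rw [exitAfterAvoiding_eq_measureReal_iUnion, measureReal_def]
  refine ENNReal.summable_toReal ?_
  rw [← measure_iUnion (disjoint_iUnion_exitEvent Gr p A) (fun q => measurableSet_iUnion_exitEvent Gr p q A)]
  exact measure_ne_top _ _

/-- `Σ'_q E(p,q,A) ≤ 1`. [folklore] -/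
theorem tsum_exitAfterAvoiding_le_one [NeZero d] (Gr : SimpleGraph (Site d)) (p : Site d) (A : Set (Site d)) :
    ∑' q, exitAfterAvoiding Gr p q A ≤ 1 := by
  rw [tsum_exitAfterAvoiding_eq_measureReal]
  exact measureReal_le_one

/-- `0 ≤ Σ'_q E(p,q,A)`. [folklore] -/
theorem tsum_exitAfterAvoiding_nonneg [NeZero d] (Gr : SimpleGraph (Site d)) (p : Site d) (A : Set (Site d)) :
    0 ≤ ∑' q, exitAfterAvoiding Gr p q A :=
  tsum_nonneg fun q => exitAfterAvoiding_nonneg Gr p q A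

/-- **Monotonicity in the avoided set**, summed form: `A ⊆ B → Σ'_q E(p,q,B) ≤ Σ'_q E(p,q,A)`. [folklore] -/
theorem tsum_exitAfterAvoiding_mono [NeZero d] (Gr : SimpleGraph (Site d)) (p : Site d) {A B : Set (Site d)}
    (hAB : A ⊆ B) : ∑' q, exitAfterAvoiding Gr p q B ≤ ∑' q, exitAfterAvoiding Gr p q A :=
  (summable_exitAfterAvoiding Gr p B).tsum_le_tsum (fun q => exitAfterAvoiding_mono Gr p q hAB)
    (summable_exitAfterAvoiding Gr p A)

/-- From a start in `A` no excursion avoids `A`: `E(p,q,A) = 0` for `p ∈ A`. [folklore] -/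
theorem exitAfterAvoiding_of_mem [NeZero d] (Gr : SimpleGraph (Site d)) {p : Site d} (q : Site d)
    {A : Set (Site d)} (hp : p ∈ A) : exitAfterAvoiding Gr p q A = 0 := by
  rw [exitAfterAvoiding_first_step, if_pos hp]

/-- **The first-step equation summed over the last vertex.** For `p ∉ A`,
`Σ'_q E(p,q,A) = #killingDirs(p)/(2d) + (2d)⁻¹ Σ_e [p ∼ p+e] Σ'_q E(p+e,q,A)`; for `p ∈ A` the
sum vanishes. [folklore] -/
theorem tsum_exitAfterAvoiding_first_step [NeZero d] (Gr : SimpleGraph (Site d)) (p : Site d)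
    (A : Set (Site d)) :
    ∑' q, exitAfterAvoiding Gr p q A = if p ∈ A then 0 else
      (2 * d : ℝ)⁻¹ * (killingDirs Gr p).card + (2 * d : ℝ)⁻¹ *
        ∑ e : Dir d, if Gr.Adj p (p + stepVec e) then ∑' q, exitAfterAvoiding Gr (p + stepVec e) q A else 0 := by
  by_cases hp : p ∈ A
  · rw [if_pos hp]
    simp [exitAfterAvoiding_of_mem Gr _ hp]
  rw [if_neg hp]
  have hterm : ∀ q, exitAfterAvoiding Gr p q A =
      (if p = q then (2 * d : ℝ)⁻¹ * (killingDirs Gr p).card else 0) + (2 * d : ℝ)⁻¹ *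
        ∑ e : Dir d, if Gr.Adj p (p + stepVec e) then exitAfterAvoiding Gr (p + stepVec e) q A else 0 := by
    intro q
    rw [exitAfterAvoiding_first_step, if_neg hp]
  have hsum1 : Summable fun q : Site d => if p = q then (2 * d : ℝ)⁻¹ * (killingDirs Gr p).card else 0 :=
    summable_of_ne_finset_zero (s := {p}) (by
      intro q hq
      rw [Finset.mem_singleton] at hq
      exact if_neg (Ne.symm hq))
  have hsumE : ∀ e : Dir d, Summable fun q : Site d =>
      if Gr.Adj p (p + stepVec e) then exitAfterAvoiding Gr (p + stepVec e) q A else 0 := by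
    intro e
    by_cases he : Gr.Adj p (p + stepVec e)
    · simp only [he, if_true]; exact summable_exitAfterAvoiding Gr _ A
    · simp only [he, if_false]; exact summable_zero
  have hsum2 : Summable fun q : Site d => (2 * d : ℝ)⁻¹ *
      ∑ e : Dir d, if Gr.Adj p (p + stepVec e) then exitAfterAvoiding Gr (p + stepVec e) q A else 0 :=
    (summable_sum fun e _ => hsumE e).mul_left _
  simp_rw [hterm]
  rw [hsum1.tsum_add hsum2, tsum_eq_single p (fun q hq => if_neg (fun h => hq h.symm)), if_pos rfl,
    tsum_mul_left, Summable.tsum_finsetSum (fun e _ => hsumE e)]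
  congr 2
  refine Finset.sum_congr rfl fun e _ => ?_
  split_ifs with he
  · rfl
  · exact tsum_zero

/-- A start with no `Gr`-edge in any lattice direction is killed at once: `Σ'_q E(p,q,A) = 1`
for `p ∉ A`. [folklore] -/
theorem tsum_exitAfterAvoiding_of_forall_not_adj [NeZero d] (Gr : SimpleGraph (Site d)) {p : Site d}
    {A : Set (Site d)} (hp : p ∉ A) (hiso : ∀ e : Dir d, ¬ Gr.Adj p (p + stepVec e)) :
    ∑' q, exitAfterAvoiding Gr p q A = 1 := by
  rw [tsum_exitAfterAvoiding_first_step, if_neg hp]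
  have hcard : (killingDirs Gr p).card = 2 * d := by
    rw [killingDirs, Finset.filter_true_of_mem (fun e _ => hiso e), Finset.card_univ, card_dir]
  have hsum : ∑ e : Dir d, (if Gr.Adj p (p + stepVec e) then ∑' q, exitAfterAvoiding Gr (p + stepVec e) q A
      else 0) = 0 := Finset.sum_eq_zero fun e _ => if_neg (hiso e)
  rw [hcard, hsum, mul_zero, add_zero]
  have hd : (2 * d : ℝ) ≠ 0 := by
    have := NeZero.ne d
    positivity
  push_cast
  exact inv_mul_cancel₀ hd

end SRW

/-! ### On `ℤ²`: the hitting probability is harmonic for the killed walk -/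

section Planar

variable (Gr : SimpleGraph (Site 2))

/-- Killing directions and edge directions at a site of `ℤ²` number four in all. [folklore] -/
theorem SRW.card_killingDirs_add_sum (p : Site 2) :
    ((SRW.killingDirs Gr p).card : ℝ) + ∑ e : SRW.Dir 2, (if Gr.Adj p (p + SRW.stepVec e) then (1 : ℝ) else 0) = 4 := by
  rw [SRW.killingDirs, Finset.card_filter, Nat.cast_sum, ← Finset.sum_add_distrib]
  have h : ∀ e ∈ (Finset.univ : Finset (SRW.Dir 2)),
      ((if ¬ Gr.Adj p (p + SRW.stepVec e) then 1 else 0 : ℕ) : ℝ) +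
        (if Gr.Adj p (p + SRW.stepVec e) then (1 : ℝ) else 0) = 1 := by
    intro e _
    split_ifs <;> simp
  rw [Finset.sum_congr rfl h, Finset.sum_const, Finset.card_univ, SRW.card_dir]
  norm_num

/-- **The probability of visiting `A` before the killing (or of never being killed) is harmonic
for the killed walk off `A`.** For every graph `Gr` on `ℤ²` and every `A`, the function
`v ↦ 1 - Σ'_q E_Gr(v,q,A)` satisfies `h v = killedAvg Gr h v` at every `v ∉ A` (first-step
equation; the killed directions contribute the cemetery value `0`). [folklore] -/
theorem isKilledHarmonicOn_one_sub_tsum_exitAfterAvoiding (A : Set (Site 2)) :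
    IsKilledHarmonicOn Gr (fun v => 1 - ∑' q, SRW.exitAfterAvoiding Gr v q A) Aᶜ := by
  intro v hv
  have hvA : v ∉ A := hv
  change 1 - ∑' q, SRW.exitAfterAvoiding Gr v q A = killedAvg Gr _ v
  rw [killedAvg_def]
  have h := SRW.tsum_exitAfterAvoiding_first_step Gr v A
  rw [if_neg hvA] at h
  have hcard := SRW.card_killingDirs_add_sum Gr v
  have hsplit : ∑ e : SRW.Dir 2, (if Gr.Adj v (v + SRW.stepVec e) then
      (1 - ∑' q, SRW.exitAfterAvoiding Gr (v + SRW.stepVec e) q A) else 0) =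
      ∑ e : SRW.Dir 2, (if Gr.Adj v (v + SRW.stepVec e) then (1 : ℝ) else 0) -
        ∑ e : SRW.Dir 2, (if Gr.Adj v (v + SRW.stepVec e) then
          ∑' q, SRW.exitAfterAvoiding Gr (v + SRW.stepVec e) q A else 0) := by
    rw [← Finset.sum_sub_distrib]
    refine Finset.sum_congr rfl fun e _ => ?_
    split_ifs <;> simp
  rw [hsplit, h]
  push_cast at h ⊢
  linarith

/-- On `A` the function is `1`. [folklore] -/
theorem one_sub_tsum_exitAfterAvoiding_of_mem {A : Set (Site 2)} {v : Site 2} (hv : v ∈ A) :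
    1 - ∑' q, SRW.exitAfterAvoiding Gr v q A = 1 := by
  simp [SRW.exitAfterAvoiding_of_mem Gr _ hv]

/-- At a site with no `Gr`-edge (and not in `A`) the function vanishes: the walk is killed at its
first step. [folklore] -/
theorem one_sub_tsum_exitAfterAvoiding_of_forall_not_adj {A : Set (Site 2)} {v : Site 2} (hv : v ∉ A)
    (hiso : ∀ e : SRW.Dir 2, ¬ Gr.Adj v (v + SRW.stepVec e)) :
    1 - ∑' q, SRW.exitAfterAvoiding Gr v q A = 0 := by
  rw [SRW.tsum_exitAfterAvoiding_of_forall_not_adj Gr hv hiso, sub_self]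

/-- The function takes values in `[0, 1]`. [folklore] -/
theorem one_sub_tsum_exitAfterAvoiding_mem_Icc (A : Set (Site 2)) (v : Site 2) :
    1 - ∑' q, SRW.exitAfterAvoiding Gr v q A ∈ Icc (0 : ℝ) 1 :=
  ⟨sub_nonneg.2 (SRW.tsum_exitAfterAvoiding_le_one Gr v A),
    sub_le_self _ (SRW.tsum_exitAfterAvoiding_nonneg Gr v A)⟩

/-- The function is monotone in `A`. [folklore] -/
theorem one_sub_tsum_exitAfterAvoiding_mono {A B : Set (Site 2)} (hAB : A ⊆ B) (v : Site 2) :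
    1 - ∑' q, SRW.exitAfterAvoiding Gr v q A ≤ 1 - ∑' q, SRW.exitAfterAvoiding Gr v q B :=
  sub_le_sub_left (SRW.tsum_exitAfterAvoiding_mono Gr v hAB) 1

/-- **Dirichlet characterisation on a finite set.** On every finite `S` disjoint from `A` the
function is the killed-harmonic extension of its own values (so the maximum, minimum and
comparison principles of `KilledWalkLaplacian.lean` apply to it). [folklore] -/
theorem one_sub_tsum_exitAfterAvoiding_eq_killedHarmExt {A S : Set (Site 2)} (hS : S.Finite)
    (hSA : Disjoint S A) : ∀ v ∈ S, 1 - ∑' q, SRW.exitAfterAvoiding Gr v q A =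
      killedHarmExt Gr S (fun x => 1 - ∑' q, SRW.exitAfterAvoiding Gr x q A) v :=
  ((isKilledHarmonicOn_one_sub_tsum_exitAfterAvoiding Gr A).mono
    (fun _ hv hvA => Set.disjoint_left.1 hSA hv hvA)).eq_killedHarmExt hS fun _ _ => rfl

end Planar

/-! ### The walk of the lemma: `Gr = siteGraph V`, killed at its first step out of `V` -/

section SiteGraph

variable {V : Set (Site 2)}

/-- In `siteGraph V` the lattice step `v → v + e` is an edge iff both ends lie in `V`. [folklore] -/
theorem siteGraph_adj_add_stepVec_iff (v : Site 2) (e : SRW.Dir 2) :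
    (ChordalLERW.siteGraph V).Adj v (v + SRW.stepVec e) ↔ v ∈ V ∧ v + SRW.stepVec e ∈ V := by
  rw [ChordalLERW.siteGraph_adj_iff]
  exact ⟨fun h => h.2, fun h => ⟨zdGraph_adj_add_stepVec v e, h⟩⟩

/-- Off `V` (and off `A`) the walk is killed at its first step: the function vanishes. [folklore] -/
theorem one_sub_tsum_exitAfterAvoiding_siteGraph_of_not_mem {A : Set (Site 2)} {v : Site 2}
    (hvV : v ∉ V) (hvA : v ∉ A) :
    1 - ∑' q, SRW.exitAfterAvoiding (ChordalLERW.siteGraph V) v q A = 0 :=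
  one_sub_tsum_exitAfterAvoiding_of_forall_not_adj _ hvA fun e h =>
    hvV ((siteGraph_adj_add_stepVec_iff v e).1 h).1

/-- **Lattice harmonicity.** For `A ⊆ V` the function `v ↦ 1 - Σ'_q E_{siteGraph V}(v,q,A)` —
the probability that the walk from `v`, killed at its first step out of `V`, visits `A` before
the killing (or is never killed) — is lattice harmonic on `V ∖ A` for the nearest-neighbour
Laplacian of `ℤ²`, equal to `1` on `A` and to `0` off `V`. [folklore] -/
theorem isLatticeHarmonicOn_one_sub_tsum_exitAfterAvoiding {A : Set (Site 2)} (hAV : A ⊆ V) :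
    IsLatticeHarmonicOn (fun v => 1 - ∑' q, SRW.exitAfterAvoiding (ChordalLERW.siteGraph V) v q A) (V \ A) := by
  intro v hv
  have hharm := isKilledHarmonicOn_one_sub_tsum_exitAfterAvoiding (ChordalLERW.siteGraph V) A v hv.2
  rw [killedAvg_def] at hharm
  -- the killed directions carry the value `0` of the function itself
  have hsum : ∑ e : SRW.Dir 2, (if (ChordalLERW.siteGraph V).Adj v (v + SRW.stepVec e) then
      (1 - ∑' q, SRW.exitAfterAvoiding (ChordalLERW.siteGraph V) (v + SRW.stepVec e) q A) else 0) =
      ∑ e : SRW.Dir 2, (1 - ∑' q, SRW.exitAfterAvoiding (ChordalLERW.siteGraph V) (v + SRW.stepVec e) q A) := by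
    refine Finset.sum_congr rfl fun e _ => ?_
    split_ifs with he
    · rfl
    · have heV : v + SRW.stepVec e ∉ V := fun h => he ((siteGraph_adj_add_stepVec_iff v e).2 ⟨hv.1, h⟩)
      exact (one_sub_tsum_exitAfterAvoiding_siteGraph_of_not_mem heV (fun h => heV (hAV h))).symm
  rw [hsum, sum_dir_eq_sum_cornerUnit (fun x => 1 - ∑' q,
    SRW.exitAfterAvoiding (ChordalLERW.siteGraph V) (v + x) q A)] at hharm
  rw [latticeLaplacian_eq]
  linarith

end SiteGraph

/-! ### Consequences for `LSWGrid.hitBeforeExitProb` -/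

namespace LSWGrid

variable (D : Set ℂ)

/-- `hitBeforeExitProb` unfolded. [folklore] -/
theorem hitBeforeExitProb_eq (w : Site 2) (B : Set (Site 2)) : hitBeforeExitProb D w B =
    1 - ∑' q, SRW.exitAfterAvoiding (ChordalLERW.siteGraph (latticeVertices D)) w q B := rfl

/-- **The hitting probability is the probability of one event**: one minus the probability that
the walk from `w` is killed (steps out of `V(D)`) at a finite time having avoided `B` up to then.
[folklore] -/
theorem hitBeforeExitProb_eq_one_sub_measureReal (w : Site 2) (B : Set (Site 2)) :
    hitBeforeExitProb D w B = 1 - (SRW.pathLaw 2).real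
      (⋃ q, ⋃ n, SRW.exitEvent (ChordalLERW.siteGraph (latticeVertices D)) n w q B) := by
  rw [hitBeforeExitProb_eq, SRW.tsum_exitAfterAvoiding_eq_measureReal]

/-- `hitBeforeExitProb ∈ [0, 1]`. [folklore] -/
theorem hitBeforeExitProb_mem_Icc (w : Site 2) (B : Set (Site 2)) :
    hitBeforeExitProb D w B ∈ Icc (0 : ℝ) 1 :=
  one_sub_tsum_exitAfterAvoiding_mem_Icc _ B w

/-- `0 ≤ hitBeforeExitProb`. [folklore] -/
theorem hitBeforeExitProb_nonneg (w : Site 2) (B : Set (Site 2)) : 0 ≤ hitBeforeExitProb D w B :=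
  (hitBeforeExitProb_mem_Icc D w B).1

/-- `hitBeforeExitProb ≤ 1`. [folklore] -/
theorem hitBeforeExitProb_le_one (w : Site 2) (B : Set (Site 2)) : hitBeforeExitProb D w B ≤ 1 :=
  (hitBeforeExitProb_mem_Icc D w B).2

/-- **Monotonicity in the target**: a larger set is easier to hit before the exit. [folklore] -/
theorem hitBeforeExitProb_mono (w : Site 2) {B B' : Set (Site 2)} (hBB' : B ⊆ B') :
    hitBeforeExitProb D w B ≤ hitBeforeExitProb D w B' :=
  one_sub_tsum_exitAfterAvoiding_mono _ hBB' w

/-- From a start in the target the target is hit at once. [folklore] -/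
theorem hitBeforeExitProb_eq_one_of_mem {w : Site 2} {B : Set (Site 2)} (hw : w ∈ B) :
    hitBeforeExitProb D w B = 1 :=
  one_sub_tsum_exitAfterAvoiding_of_mem _ hw

/-- From a start outside `V(D)` (and outside the target) the walk is killed at its first step. [folklore] -/
theorem hitBeforeExitProb_eq_zero_of_not_mem {w : Site 2} {B : Set (Site 2)} (hw : w ∉ latticeVertices D)
    (hwB : w ∉ B) : hitBeforeExitProb D w B = 0 :=
  one_sub_tsum_exitAfterAvoiding_siteGraph_of_not_mem hw hwB

/-- **Harmonicity for the killed walk**: `v ↦ hitBeforeExitProb D v B` is harmonic for the walk on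
`V(D)` killed at its first step out of `V(D)`, at every `v ∉ B`. [folklore] -/
theorem hitBeforeExitProb_isKilledHarmonicOn (B : Set (Site 2)) :
    IsKilledHarmonicOn (ChordalLERW.siteGraph (latticeVertices D)) (fun v => hitBeforeExitProb D v B) Bᶜ :=
  isKilledHarmonicOn_one_sub_tsum_exitAfterAvoiding _ B

/-- **Lattice harmonicity**: for a target `B ⊆ V(D)`, `v ↦ hitBeforeExitProb D v B` is lattice
harmonic on `V(D) ∖ B`, equal to `1` on `B` and to `0` off `V(D)` — the discrete Dirichlet
problem "harmonic measure of `B` for the walk stopped on `∂D`" of the printed proof. [folklore] -/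
theorem hitBeforeExitProb_isLatticeHarmonicOn {B : Set (Site 2)} (hB : B ⊆ latticeVertices D) :
    IsLatticeHarmonicOn (fun v => hitBeforeExitProb D v B) (latticeVertices D \ B) :=
  isLatticeHarmonicOn_one_sub_tsum_exitAfterAvoiding hB

/-- **Truncation to a finite window.** Enlarging the target by the sites of `V(D)` outside a window
`W` only increases the hitting probability; for finite `W` the enlarged problem lives on the finite
set `(V(D) ∩ W) ∖ B`. [folklore] -/
theorem hitBeforeExitProb_le_window (w : Site 2) (B W : Set (Site 2)) :
    hitBeforeExitProb D w B ≤ hitBeforeExitProb D w (B ∪ (latticeVertices D \ W)) :=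
  hitBeforeExitProb_mono D w subset_union_left

/-- **The windowed hitting probability solves a finite Dirichlet problem with data `1`**: on
`S = (V(D) ∩ W) ∖ B`, `W` finite, it is `killedHarmExt (siteGraph V(D)) S 1` — every site of the
outer boundary of `S` reachable by an edge of the walk lies in `B` or outside the window, where the
function is `1`, while the killing enters through the cemetery value `0`. [folklore] -/
theorem hitBeforeExitProb_window_eq_killedHarmExt_one {W : Set (Site 2)} (hW : W.Finite) (B : Set (Site 2)) :
    ∀ v ∈ (latticeVertices D ∩ W) \ B, hitBeforeExitProb D v (B ∪ (latticeVertices D \ W)) =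
      killedHarmExt (ChordalLERW.siteGraph (latticeVertices D)) ((latticeVertices D ∩ W) \ B) (fun _ => 1) v := by
  set V := latticeVertices D
  set S := (V ∩ W) \ B with hS
  have hSfin : S.Finite := (hW.inter_of_right V).sdiff
  have hsub : S ⊆ (B ∪ (V \ W))ᶜ := by
    rintro v ⟨⟨hvV, hvW⟩, hvB⟩ (h | h)
    · exact hvB h
    · exact h.2 hvW
  refine ((hitBeforeExitProb_isKilledHarmonicOn D (B ∪ (V \ W))).mono hsub).eq_killedHarmExt hSfin ?_
  rintro x ⟨hxS, v, hv, e, rfl, hadj⟩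
  have hxV : v + SRW.stepVec e ∈ V := ((siteGraph_adj_add_stepVec_iff v e).1 hadj).2
  refine hitBeforeExitProb_eq_one_of_mem D ?_
  by_cases hxB : v + SRW.stepVec e ∈ B
  · exact Or.inl hxB
  · refine Or.inr ⟨hxV, fun hxW => hxS ⟨⟨hxV, hxW⟩, hxB⟩⟩

/-- **Upper bound by a finite Dirichlet problem**: for every finite window `W` and `w ∈ V(D) ∩ W ∖ B`,
`hitBeforeExitProb D w B ≤ killedHarmExt (siteGraph V(D)) ((V(D) ∩ W) ∖ B) 1 w` — the probability
that the walk from `w` reaches `B` or leaves the window before being killed. [folklore] -/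
theorem hitBeforeExitProb_le_killedHarmExt_window {W : Set (Site 2)} (hW : W.Finite) {B : Set (Site 2)}
    {w : Site 2} (hw : w ∈ (latticeVertices D ∩ W) \ B) :
    hitBeforeExitProb D w B ≤
      killedHarmExt (ChordalLERW.siteGraph (latticeVertices D)) ((latticeVertices D ∩ W) \ B) (fun _ => 1) w := by
  rw [← hitBeforeExitProb_window_eq_killedHarmExt_one D hW B w hw]
  exact hitBeforeExitProb_le_window D w B W

end LSWGrid

end Literature.Probability.LatticeModels
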